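import Summits.BirchSwinnertonDyer.BirchSwinnertonDyer.Theorems.TeichmullerTwistDescentStarInvolutionTorsionCorners
import HarnessLib

/-!
# Route `TeichmullerTwistDescent`: `p² ∤ c₀` AT EVERY ADDITIVE POTENTIALLY GOOD `p ∈ {5, 7}` WITH `E[p]`
# IRREDUCIBLE, granted Kato's fact, Modularity and Dokchitser–Dokchitser — Edixhoven's Prop. 9 below `p = 11`
# (star involution, `--supports` LOW stmt-BirchSwinnertonDyer-23884)

Cell `pub/bsd-wall` (D-0145 line route-BirchSwinnertonDyer-TeichmullerTwistDescent, rev 2), seat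
`bsd-line-ttd-p1` (prover 1/2, g2, item SCMU57). THEOREMS ONLY (no definition, no named fact, no `sorry`);
nothing is booked, no item is closed, BSD is not proved by this.

WHAT. Edixhoven 1991 Prop. 9 ("under the hypotheses of this section, one has `v_p(c) ≤ 1`") is stated for
`p > 7` (Prop. 7 needs the semistability defect `< p − 1`). At `p ∈ {5, 7}` the tree now has, for an
`X₀`-optimal `W` (lattice-optimal conductor-level datum) additive and potentially good at `p` with `E[p]`
irreducible: (i) `p ∤ c` if `W(ℚ_p)[p] = 0`, GRANTED Kato's fact F″ (seat ttd-p2,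
`TeichmullerTwistDescent.cell57_of_kato57_of_noPTorsion`); (ii) `W(ℚ_p)[p] ≠ 0` forces Kodaira II/III at `5`,
II at `7` (Mazur 1977 III §5, `Additive.padicValInt_minimalDiscriminantInt_of_prime_zsmul_eq_zero_of_addv`);
(iii) on those, `ord_p c ≤ 1` by the star involution (`padicValInt_c_le_one_of_unstarred_of_kato`, companion
file). This file assembles the three into ONE statement:

* `padicValInt_c_le_one_of_addv_fiveSeven` — **granted F″ (`kato_neron_isIntegral_twistedSymbolSum_of_additive_five_le`),
  Modularity (`exists_isNewformOf`) and Dokchitser–Dokchitser (`hDD`, used only on Kodaira III at `5`): for every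
  globally minimal `W`, `p ∈ {5, 7}`, additive at `p`, `E[p]` irreducible, no `Iₙ*` fibre at `(p)`, and every
  lattice-optimal conductor-level datum `D`: `ord_p c(D) ≤ 1`.** I.e. `p² ∤ c₀` on the whole additive
  potentially good locus at `5` and `7` — the `p ∈ {5, 7}` twin of Edixhoven's Prop. 9, conditional on print
  (Kato) instead of on a stable model.
* `padicValInt_c_le_one_of_addv_fiveSeven_of_bundles` — the same keyed on the route's bundles
  `KatoNeronAndCremonaFacts` and `PublishedInputsAdditiveKoly`.

References: [EdixhovenManin1991] Prop. 9 and Thm. 3 (typescript L115–118, L560–566); [Kato2004Asterisque] Thm. 9.7;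
[Mazur1977] Ch. III §5; [KostersPannekoek2017] Cor. 2; [DokchitserDokchitser2015LocalInvariants] Thm. 5.1 (1).
-/

set_option autoImplicit false
-- single-conjunct summit: `Summit.BirchSwinnertonDyer.BirchSwinnertonDyer.…` repeats the name by design
set_option linter.dupNamespace false

noncomputable section

open scoped Classical NumberField

open WeierstrassCurve IsDedekindDomain Rat.HeightOneSpectrum
  Literature.NumberTheory.EllipticCurves Literature.NumberTheory.EllipticCurves.ModularForms
  Literature.NumberTheory.EllipticCurves.Rank1Residual Literature.NumberTheory.DiophantineGeometry
  Summit.BirchSwinnertonDyer.Rank1Residual Summit.BirchSwinnertonDyer.Rank1Residual.Additive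
  Literature.NumberTheory.Automorphic
open Summit.BirchSwinnertonDyer.BirchSwinnertonDyer.Theorems.TeichmullerTwistDescent
open Summit.BirchSwinnertonDyer.BirchSwinnertonDyer.Theses.TeichmullerTwistDescent

namespace Summit.BirchSwinnertonDyer.BirchSwinnertonDyer.Theorems.TeichmullerTwistDescentStarInvolution

/-- **`p² ∤ c₀` at every additive potentially good `p ∈ {5, 7}` with `E[p]` irreducible**, granted Kato's
fact (`hK`), Modularity (`hnf`) and Dokchitser–Dokchitser (`hDD`, Kodaira III at `5` only): for a globally
minimal `W`, additive at `p ∈ {5, 7}` with no `Iₙ*` fibre at `(p)` and `E[p]` irreducible, and a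
lattice-optimal datum `D` at the conductor level, `ord_p c(D) ≤ 1`. Proof: if `W(ℚ_p)` has no point of order
`p`, Kato's cell gives `p ∤ c` (`cell57_of_kato57_of_noPTorsion`); otherwise the Kodaira type is II or III at
`5`, II at `7` (`Additive.padicValInt_minimalDiscriminantInt_of_prime_zsmul_eq_zero_of_addv`), the starred twist's
class has `ord_p Δ_min ≥ 4` (type II: `four_le_of_isIsogenous_of_padicValInt_eq_eight`; type III at `5`:
`(G)`-ordinary, `ManinFrameResidueProperTwistDegree.not_typeGOrd_or_four_lt_of_isIsogenous` with `hDD`), and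
`padicValInt_c_le_one_of_unstarred_of_kato` bounds `W`. [cite: EdixhovenManin1991, Prop. 9 (typescript L560–566)]
[cite: Kato2004Asterisque, Thm. 9.7 (p. 189)] [cite: Mazur1977, Ch. III §5, Step 1, p. 158]
[cite: DokchitserDokchitser2015LocalInvariants, Thm. 5.1 (1)] -/
theorem padicValInt_c_le_one_of_addv_fiveSeven
    (hK : kato_neron_isIntegral_twistedSymbolSum_of_additive_five_le) (hnf : exists_isNewformOf)
    (hDD : dokchitser_padicValInt_minimalDiscriminantInt_eq_of_isogeny_of_not_dvd_degree) :
    ∀ (W : WeierstrassCurve ℚ) [W.IsElliptic] [W.IsGloballyMinimal] (p : ℕ) [Fact p.Prime]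
      [NeZero (W.conductorNorm ℤ)] (D : ModularParametrizationData W (W.conductorNorm ℤ)),
      (p = 5 ∨ p = 7) → Addv W p → Irr W p →
      (∀ n : ℕ, W.kodairaSymbolAt (placeOf p) ≠ .Istar n) →
      (∀ z ∈ D.L.lattice, ∃ w ∈ periodLattice D.f, z = D.c * w) → padicValInt p D.c ≤ 1 := by
  intro W _ _ p hpF _ D hp57 hadd hirr hnI hopt
  have hp5 : 5 ≤ p := by rcases hp57 with rfl | rfl <;> norm_num
  have hp2 : p ≠ 2 := by omega
  by_cases hPT : ∀ P : (W.baseChange ℚ_[p]).toAffine.Point, p • P = 0 → P = 0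
  · -- no local `p`-torsion: Kato's cell gives a unit
    have h0 : ¬ (p : ℤ) ∣ D.c := cell57_of_kato57_of_noPTorsion hK W p D hp57 hadd hirr hPT hopt
    rw [padicValInt.eq_zero_of_not_dvd h0]
    exact zero_le_one
  -- a `ℚ_p`-rational point of order `p`: Kodaira II/III at `5`, II at `7`
  push Not at hPT
  obtain ⟨P, hP, hP0⟩ := hPT
  have hlow := padicValInt_minimalDiscriminantInt_of_prime_zsmul_eq_zero_of_addv W p hp5 hadd hP0
    (by rw [natCast_zsmul]; exact hP)
  have hW6 : padicValInt p W.minimalDiscriminantInt < 6 := by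
    rcases hlow with ⟨-, h | h⟩ | ⟨-, h⟩ <;> omega
  have hjW : 0 ≤ padicValRat p W.j :=
    ManinFrameResidueProperRTameTwist.padicValRat_j_nonneg_of_addv_of_forall_kodairaSymbolAt_ne_Istar
      W hp2 hadd (placeOf p) (natGenerator_placeOf p) hnI
  -- the starred twist
  obtain ⟨V, hVe, hVm, C, hC⟩ := exists_minimal_twist_pStar p W
  haveI := hVe
  haveI := hVm
  obtain ⟨haddV, hjV, -⟩ := addv_of_twist_pStar p hp2 W V hjW hW6 C hC
  obtain ⟨-, hordV⟩ := padicValRat_u_eq_zero_and_padicValInt_eq_of_twist_pStar p hp2 W V hW6 C hC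
  have hirrV : Irr V p :=
    BurungaleSkinnerTianWan2024.hasIrreducibleModPGaloisRep_of_smul_eq_quadraticTwist W V p
      (pStar_ne_zero p) (C := C⁻¹) (by rw [← hC, inv_smul_smul]) hirr
  refine padicValInt_c_le_one_of_unstarred_of_kato p hK hnf hp57 W V hadd hirr hnI hW6 C hC
    (fun V₀ _ _ hiso haddV₀ ↦ ?_) D hopt
  -- every member of the twisted class has `ord_p Δ_min ≥ 4`
  by_cases h2 : padicValInt p W.minimalDiscriminantInt = 2
  · -- type II (at `5` or `7`): the twist is IV*, defect `3`, no `hDD` needed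
    exact four_le_of_isIsogenous_of_padicValInt_eq_eight p hp5 V V₀ hjV (by omega) hiso haddV₀
  · -- type III at `5`: `(G)`-ordinary; the twist III* stays off `ord_p Δ_min ≤ 4` along the class by `hDD`
    have h3 : padicValInt p W.minimalDiscriminantInt = 3 := by
      rcases hlow with ⟨-, h | h⟩ | ⟨-, h⟩ <;> omega
    have hp5' : p = 5 := by
      rcases hlow with ⟨h, -⟩ | ⟨h5, h⟩
      · exact h
      · omega
    subst hp5'
    have hG : TypeGOrd W 5 := by
      refine typeGOrd_of_addv_of_subGordHigher W 5 hp5 hadd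
        ⟨⟨not_lt.mpr hjW, condExpTwo_of_addv_of_five_le W 5 hp5 hadd, ?_⟩, ?_⟩ <;>
        unfold semistabilityIndex <;> rw [h3] <;> norm_num
    have hGV : TypeGOrd V 5 :=
      (typeGOrd_iff_of_star_pair 5 hp5 V W haddV hadd hjV hjW (by omega)).mpr hG
    rcases ManinFrameResidueProperTwistDegree.not_typeGOrd_or_four_lt_of_isIsogenous (p := 5) hDD hp5 haddV
        hirrV hiso (by omega) with hnG₀ | h4
    · exact absurd ((typeGOrd_iff_of_isIsogenous (by norm_num) haddV hiso).mp hGV) hnG₀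
    · omega

/-- **The same keyed on the route's bundles** `KatoNeronAndCremonaFacts` (F″ is its first conjunct) and
`PublishedInputsAdditiveKoly` (Modularity is its sixth conjunct), plus `hDD`.
[cite: EdixhovenManin1991, Prop. 9] [cite: Kato2004Asterisque, Thm. 9.7 (p. 189)] -/
theorem padicValInt_c_le_one_of_addv_fiveSeven_of_bundles (hPK : KatoNeronAndCremonaFacts)
    (hP : PublishedInputsAdditiveKoly)
    (hDD : dokchitser_padicValInt_minimalDiscriminantInt_eq_of_isogeny_of_not_dvd_degree) :
    ∀ (W : WeierstrassCurve ℚ) [W.IsElliptic] [W.IsGloballyMinimal] (p : ℕ) [Fact p.Prime]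
      [NeZero (W.conductorNorm ℤ)] (D : ModularParametrizationData W (W.conductorNorm ℤ)),
      (p = 5 ∨ p = 7) → Addv W p → Irr W p →
      (∀ n : ℕ, W.kodairaSymbolAt (placeOf p) ≠ .Istar n) →
      (∀ z ∈ D.L.lattice, ∃ w ∈ periodLattice D.f, z = D.c * w) → padicValInt p D.c ≤ 1 :=
  padicValInt_c_le_one_of_addv_fiveSeven hPK.1 hP.2.2.2.2.2.1 hDD

/-! ### Appendix: LOW is its type-II-at-5 row -/

/-- **LOW reduces to Kodaira II at `5`.** The crux `SupersingularTorsionOptimalManinUnitFive` (LOW,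
stmt-BirchSwinnertonDyer-23884) lists the rows `(p, ord_p Δ_min) ∈ {(5,2), (5,3), (7,2)}` under `¬ TypeGOrd`;
but Kodaira III at `5` (`e = 4 ∣ p − 1`) and II at `7` (`e = 6 ∣ p − 1`) are `(G)`-ordinary
(`Additive.typeGOrd_of_addv_of_subGordHigher`), so those two rows are VACUOUS and LOW FOLLOWS from its single
row `(5, 2)` (type II at `5`, semistability defect `6 = p + 1`, potentially supersingular). No named fact.
[cite: EdixhovenManin1991, Prop. 6] [cite: SilvermanATAEC1994, IV Table 4.1 (PDF p. 365)] -/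
theorem supersingularTorsionOptimalManinUnitFive_of_typeII_at_five
    (h2 : ∀ (W : WeierstrassCurve ℚ) [W.IsElliptic] [W.IsGloballyMinimal] [Fact (Nat.Prime 5)]
      [NeZero (W.conductorNorm ℤ)] (D : ModularParametrizationData W (W.conductorNorm ℤ)),
      padicValInt 5 W.minimalDiscriminantInt = 2 → Addv W 5 → Irr W 5 → ¬ TypeGOrd W 5 →
      (∃ P : (W.baseChange ℚ_[5]).toAffine.Point, 5 • P = 0 ∧ P ≠ 0) →
      (∀ z ∈ D.L.lattice, ∃ w ∈ periodLattice D.f, z = D.c * w) → ¬ (5 : ℤ) ∣ D.c) :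
    SupersingularTorsionOptimalManinUnitFive := by
  intro W _ _ p _ _ D hcell hadd hirr hnG hP hopt
  have hp57 : p = 5 ∨ p = 7 := by rcases hcell with ⟨h, -⟩ | ⟨h, -⟩ <;> simp [h]
  have hp5 : 5 ≤ p := by rcases hp57 with rfl | rfl <;> norm_num
  have hp2 : p ≠ 2 := by omega
  have hle4 : padicValInt p W.minimalDiscriminantInt ≤ 4 := by
    rcases hcell with ⟨-, h | h⟩ | ⟨-, h⟩ <;> omega
  have hnI : ∀ n : ℕ, W.kodairaSymbolAt (placeOf p) ≠ .Istar n :=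
    forall_ne_Istar_of_padicValInt_le_four W p hp5 hadd hle4
  have hjW : 0 ≤ padicValRat p W.j :=
    ManinFrameResidueProperRTameTwist.padicValRat_j_nonneg_of_addv_of_forall_kodairaSymbolAt_ne_Istar
      W hp2 hadd (placeOf p) (natGenerator_placeOf p) hnI
  have hcW : CondExpTwo W p := condExpTwo_of_addv_of_five_le W p hp5 hadd
  rcases hcell with ⟨rfl, h | h3⟩ | ⟨rfl, h⟩
  · exact h2 W D h hadd hirr hnG hP hopt
  · exfalso
    refine hnG (typeGOrd_of_addv_of_subGordHigher W 5 hp5 hadd ⟨⟨not_lt.mpr hjW, hcW, ?_⟩, ?_⟩) <;>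
      unfold semistabilityIndex <;> rw [h3] <;> norm_num
  · exfalso
    refine hnG (typeGOrd_of_addv_of_subGordHigher W 7 hp5 hadd ⟨⟨not_lt.mpr hjW, hcW, ?_⟩, ?_⟩) <;>
      unfold semistabilityIndex <;> rw [h] <;> norm_num

/-- Conversely LOW contains its type-II row, so **LOW ⟺ its `(5, 2)` row**. [folklore] -/
theorem supersingularTorsionOptimalManinUnitFive_iff_typeII_at_five :
    SupersingularTorsionOptimalManinUnitFive ↔
      ∀ (W : WeierstrassCurve ℚ) [W.IsElliptic] [W.IsGloballyMinimal] [Fact (Nat.Prime 5)]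
        [NeZero (W.conductorNorm ℤ)] (D : ModularParametrizationData W (W.conductorNorm ℤ)),
        padicValInt 5 W.minimalDiscriminantInt = 2 → Addv W 5 → Irr W 5 → ¬ TypeGOrd W 5 →
        (∃ P : (W.baseChange ℚ_[5]).toAffine.Point, 5 • P = 0 ∧ P ≠ 0) →
        (∀ z ∈ D.L.lattice, ∃ w ∈ periodLattice D.f, z = D.c * w) → ¬ (5 : ℤ) ∣ D.c :=
  ⟨fun hL W _ _ _ _ D h2 hadd hirr hnG hP hopt ↦ hL W 5 D (Or.inl ⟨rfl, Or.inl h2⟩) hadd hirr hnG hP hopt,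
    supersingularTorsionOptimalManinUnitFive_of_typeII_at_five⟩

end Summit.BirchSwinnertonDyer.BirchSwinnertonDyer.Theorems.TeichmullerTwistDescentStarInvolution

end
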